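import Mathlib

/-!
# T5PullbackRows — the pulled-back coordinate covectors are the rows of the Jacobian

Kernel support (blind lane, Mathlib only) for route/T5-N1-hodge-p6.md §H6 / §H8–H10, the clause
listed as prose at every version since v4: «that the rows of the Jacobian in the chart ARE the
pulled-back covectors f_a^*e_{a,σ}, f_b^*e_{b,σ} (Remark A4.2.8)».

Chart model: a holomorphic map `F : (ι → 𝕜) → (κ → 𝕜)` (the chart expression
`F_{ab} = (z_a ∘ f̃_a, z_b ∘ f̃_b)` of the memo, `𝕜 = ℂ`, `ι = κ = Fin 2`), the translation-invariant
coordinate covector `e_k = dw_k` on the target, and its pull-back `F^* dw_k = d(w_k ∘ F)`, which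
Mathlib writes as `fderiv 𝕜 (fun w => F w k) z`. What is proved:

* `fderiv_coord_eq` / `fderiv_coord_apply` — `d(w_k ∘ F)_z = pr_k ∘ dF_z` (Mathlib `fderiv_apply`);
* `fderiv_coord_single` — its coefficient on the basis vector `e_i` is the Jacobian entry
  `∂F_k/∂w_i (z) = dF_z (e_i) k`, i.e. exactly the entry `jacRow` of T5SurfaceImage uses;
* `coeff_fderiv_coord` — the coefficient vector of the pulled-back covector IS the `k`-th row of the
  Jacobian;
* `fderiv_coord_eq_sum` — the covector written out: `F^* dw_k = Σ_i (∂F_k/∂w_i)(z) · dw_i`;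
* `ext_of_forall_single` / `fderiv_coord_eq_of_rows_eq` — a covector on `ι → 𝕜` is determined by its
  coefficient vector, so two pulled-back covectors with the same row are equal;
* `wedge10_rows` — for `ι = Fin 2`, the `dw₁ ∧ dw₂`-coefficient of `F^*dw_a ∧ F^*dw_b` (T5WedgeRank's
  `wedge10` of the two rows, written out) is the `2 × 2` minor of the Jacobian, so the pointwise
  criterion H6 (ii) ⟺ (iii) applies to the rows verbatim.

Nothing geometric is constructed: the abelian varieties, the universal covers and the lifts `f̃_a`
stay prose; the chart map `F` is taken as given.
-/

namespace Summit.Ventures.HodgeRepro2.T5PullbackRows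

open ContinuousLinearMap

variable {𝕜 : Type*} [NontriviallyNormedField 𝕜] {ι κ : Type*} [Fintype ι] [DecidableEq ι]

section Coord

variable {F : (ι → 𝕜) → (κ → 𝕜)} {z : ι → 𝕜}

omit [DecidableEq ι] in
/-- The pull-back of the coordinate covector `dw_k` under `F` at `z` is `pr_k ∘ dF_z`
(Mathlib's `fderiv_apply`). -/
theorem fderiv_coord_eq (hF : DifferentiableAt 𝕜 F z) (k : κ) :
    fderiv 𝕜 (fun w => F w k) z = (proj k).comp (fderiv 𝕜 F z) :=
  fderiv_apply hF k

omit [DecidableEq ι] in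
/-- Evaluated on a tangent vector `v`: `(F^* dw_k)_z (v) = (dF_z v)_k`. -/
theorem fderiv_coord_apply (hF : DifferentiableAt 𝕜 F z) (k : κ) (v : ι → 𝕜) :
    fderiv 𝕜 (fun w => F w k) z v = fderiv 𝕜 F z v k := by
  rw [fderiv_coord_eq hF k]
  rfl

/-- The coefficient of the pulled-back covector on the basis vector `e_i = Pi.single i 1` is the
Jacobian entry `∂F_k/∂w_i (z)` — the entry `fderiv 𝕜 F z (Pi.single i 1) k` of the row
`jacRow` in T5SurfaceImage. -/
theorem fderiv_coord_single (hF : DifferentiableAt 𝕜 F z) (k : κ) (i : ι) :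
    fderiv 𝕜 (fun w => F w k) z (Pi.single i 1) = fderiv 𝕜 F z (Pi.single i 1) k :=
  fderiv_coord_apply hF k _

/-- The coefficient vector of the pulled-back covector `F^* dw_k` in the basis `dw_i` IS the
`k`-th row of the Jacobian of `F` at `z`: «the rows of the Jacobian in the chart ARE the
pulled-back covectors». -/
theorem coeff_fderiv_coord (hF : DifferentiableAt 𝕜 F z) (k : κ) :
    (fun i => fderiv 𝕜 (fun w => F w k) z (Pi.single i 1)) =
      fun i => fderiv 𝕜 F z (Pi.single i 1) k := by
  funext i
  exact fderiv_coord_single hF k i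

/-- A continuous linear functional on `ι → 𝕜` is determined by its values on the basis vectors
`Pi.single i 1`: `φ v = Σ_i v i • φ (e_i)` (Mathlib's `pi_eq_sum_univ'`; for `ι = Fin 2`, `𝕜 = ℂ`
this is the statement `ShimuraData.clm_apply_eq_sum_single` of p2's AlbanesePeriodHom.lean, not
imported here because this file is index- and field-general). -/
theorem apply_eq_sum_single (φ : (ι → 𝕜) →L[𝕜] 𝕜) (v : ι → 𝕜) :
    φ v = ∑ i, v i * φ (Pi.single i 1) := by
  conv_lhs => rw [pi_eq_sum_univ' v, map_sum]
  refine Finset.sum_congr rfl fun i _ => ?_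
  rw [map_smul, smul_eq_mul]

/-- The pulled-back covector written out in coordinates: `F^* dw_k = Σ_i (∂F_k/∂w_i)(z) dw_i`,
i.e. `(F^* dw_k)_z (v) = Σ_i v_i · dF_z(e_i)_k`. -/
theorem fderiv_coord_eq_sum (hF : DifferentiableAt 𝕜 F z) (k : κ) (v : ι → 𝕜) :
    fderiv 𝕜 (fun w => F w k) z v = ∑ i, v i * fderiv 𝕜 F z (Pi.single i 1) k := by
  rw [apply_eq_sum_single]
  refine Finset.sum_congr rfl fun i _ => ?_
  rw [fderiv_coord_single hF k i]

/-- Two continuous linear functionals on `ι → 𝕜` with the same coefficient vector are equal (the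
general form of p2's `ShimuraData.clm_eq_zero_of_forall_single`, `ι = Fin 2`, `𝕜 = ℂ`). -/
theorem ext_of_forall_single (φ ψ : (ι → 𝕜) →L[𝕜] 𝕜)
    (h : ∀ i, φ (Pi.single i 1) = ψ (Pi.single i 1)) : φ = ψ := by
  ext v
  rw [apply_eq_sum_single φ, apply_eq_sum_single ψ]
  exact Finset.sum_congr rfl fun i _ => by rw [h i]

/-- Two pulled-back covectors (possibly under two different maps) with the same Jacobian row are
the same covector. -/
theorem fderiv_coord_eq_of_rows_eq {G : (ι → 𝕜) → (κ → 𝕜)} (hF : DifferentiableAt 𝕜 F z)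
    (hG : DifferentiableAt 𝕜 G z) {k l : κ}
    (h : ∀ i, fderiv 𝕜 F z (Pi.single i 1) k = fderiv 𝕜 G z (Pi.single i 1) l) :
    fderiv 𝕜 (fun w => F w k) z = fderiv 𝕜 (fun w => G w l) z :=
  ext_of_forall_single _ _ fun i => by
    rw [fderiv_coord_single hF k i, fderiv_coord_single hG l i, h i]

end Coord

section Surface

variable {F : (Fin 2 → 𝕜) → (Fin 2 → 𝕜)} {z : Fin 2 → 𝕜}

/-- For a chart map `F : 𝕜² → 𝕜²` the `dw₁ ∧ dw₂`-coefficient of `F^*dw_a ∧ F^*dw_b` — the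
expression `u 0 * v 1 − u 1 * v 0` of T5WedgeRank's `wedge10` applied to the two coefficient
vectors `u = (F^* dw_a)(e_i)`, `v = (F^* dw_b)(e_i)` — is the `2 × 2` minor of the Jacobian formed
by the rows `a`, `b`: the pointwise criterion «ω_{ab} ≠ 0 at `z` ⟺ rows `a`, `b` independent»
(H6 (ii) ⟺ (iii)) is a statement about the Jacobian rows. -/
theorem wedge10_rows (hF : DifferentiableAt 𝕜 F z) (a b : Fin 2) :
    fderiv 𝕜 (fun w => F w a) z (Pi.single 0 1) * fderiv 𝕜 (fun w => F w b) z (Pi.single 1 1) -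
        fderiv 𝕜 (fun w => F w a) z (Pi.single 1 1) * fderiv 𝕜 (fun w => F w b) z (Pi.single 0 1) =
      fderiv 𝕜 F z (Pi.single 0 1) a * fderiv 𝕜 F z (Pi.single 1 1) b -
        fderiv 𝕜 F z (Pi.single 1 1) a * fderiv 𝕜 F z (Pi.single 0 1) b := by
  rw [fderiv_coord_single hF a 0, fderiv_coord_single hF a 1, fderiv_coord_single hF b 0,
    fderiv_coord_single hF b 1]

end Surface

end Summit.Ventures.HodgeRepro2.T5PullbackRows
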